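import Mathlib
import Literature.MathematicalPhysics.KineticTheory.HardSphereEuler
import Literature.MathematicalPhysics.KineticTheory.Hilbert6Wave0
import Literature.Analysis.FluidPDE.HardSpherePhaseSpace

/-!
# Sketch — crux stmt-AtomisticToContinuum-14914 `KickFairRelEquilibrium`, crux-ideate r1 ideator 1

First lemmas of the line `affine-fibre-statics` (card `Ideas/affine-fibre-statics.md`):
conditioning the invariant law on EXACT velocities makes every constraint of the typed past
AFFINE in the fine positions, so the equilibrium predictive kick kernel is the push-forward of a
UNIFORM impact parameter.  Three elementary statements, stated over tree vocabulary
(`V3`, `sphereMeasure`, `reflectVel`); they need not be proved here (sorries), they must elaborate.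
-/

open MeasureTheory
open scoped RealInnerProductSpace

namespace Summit.AtomisticToContinuum.HydrodynamicLimit.Cruxes.KickFairRelEquilibrium.AffineFibreStatics

open Literature.MathematicalPhysics.KineticTheory Literature.Analysis.FluidPDE

/-- The contact vector of a collision with unit relative-velocity direction `e₃` and impact
parameter `b` in the unit disc of the transverse plane (units of the diameter): `ω(b) = (b, -√(1-|b|²))`,
on the INCOMING hemisphere `⟪e₃, ω⟫ ≤ 0`. -/
noncomputable def contactOfImpact (b : EuclideanSpace ℝ (Fin 2)) : V3 :=
  !₂[b 0, b 1, -Real.sqrt (1 - ‖b‖ ^ 2)]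

/-- **L1 — flux law from a uniform impact parameter (base case of fibre-uniformity).**
If the impact parameter is Lebesgue-uniform on the unit disc transverse to the relative velocity
`e₃`, the contact vector has the FLUX law `(-ω₃)₊ dS(ω)` on the unit sphere: for bounded measurable
`G : V3 → ℝ`,  `∫_{S²} G(ω) (-ω₃)₊ dS = ∫_{|b|<1} G(ω(b)) db`  (surface element `dS = db/|ω₃|` on the
lower hemisphere; `sphereMeasure = volume.toSphere` has total mass `4π`).  This is the unshielded
equilibrium kick kernel `κ` of the crux: the flux-mean. [CIP1994 App. 4.A; folklore] -/
theorem integral_flux_eq_integral_disc (G : V3 → ℝ) (hG : Measurable G) (hb : ∃ C, ∀ x, |G x| ≤ C) :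
    ∫ ω : Metric.sphere (0 : V3) 1, G ω * max (-((ω : V3) 2)) 0 ∂sphereMeasure
      = ∫ b in Metric.ball (0 : EuclideanSpace ℝ (Fin 2)) 1, G (contactOfImpact b) := by
  sorry

/-- **L2 — a resolved kick is an affine pin of codimension 2.** Given the incoming pair `(v, w)`
with `⟪v - w, n⟫ ≠ 0` (a genuine collision), the outgoing velocity of the first particle determines
the LINE of the impact vector: two impact vectors giving the same outgoing velocity are parallel.
(So a velocity snapshot before and one after a binary collision pin the transverse offset of the
pair — an affine constraint on fine positions — and nothing else.) [folklore] -/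
theorem impact_line_of_outgoing (v w n n' : V3) (hn : ⟪v - w, n⟫ ≠ 0)
    (h : (reflectVel n (v, w)).1 = (reflectVel n' (v, w)).1) : ∃ c : ℝ, n' = c • n := by
  simp only [reflectVel] at h
  have key : (⟪v - w, n⟫ / ‖n‖ ^ 2) • n = (⟪v - w, n'⟫ / ‖n'‖ ^ 2) • n' := sub_right_injective h
  have hn0 : n ≠ 0 := fun h0 => hn (by simp [h0])
  have ha : ⟪v - w, n⟫ / ‖n‖ ^ 2 ≠ 0 :=
    div_ne_zero hn (pow_ne_zero 2 (norm_ne_zero_iff.mpr hn0))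
  have ha' : ⟪v - w, n'⟫ / ‖n'‖ ^ 2 ≠ 0 := by
    intro h0
    rw [h0, zero_smul] at key
    rcases smul_eq_zero.mp key with h1 | h1
    · exact ha h1
    · exact hn0 h1
  refine ⟨(⟪v - w, n⟫ / ‖n‖ ^ 2) / (⟪v - w, n'⟫ / ‖n'‖ ^ 2), ?_⟩
  calc n' = (⟪v - w, n'⟫ / ‖n'‖ ^ 2)⁻¹ • ((⟪v - w, n'⟫ / ‖n'‖ ^ 2) • n') := by
          rw [smul_smul, inv_mul_cancel₀ ha', one_smul]
    _ = (⟪v - w, n'⟫ / ‖n'‖ ^ 2)⁻¹ • ((⟪v - w, n⟫ / ‖n‖ ^ 2) • n) := by rw [key]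
    _ = ((⟪v - w, n⟫ / ‖n‖ ^ 2) / (⟪v - w, n'⟫ / ‖n'‖ ^ 2)) • n := by
          rw [smul_smul]; congr 1; ring

/-- **L3 — tube avoidance = cap exclusion (shields as support cuts, every gap).** A third sphere
whose centre sits at `η` relative to the partner's centre (diameter `ε`) forbids exactly the contact
vectors `ω` in the cap `⟪ω, η⟫ > |η|²/(2ε)`; at contact (`|η| = ε`) this is the 60° cap
`⟪ω, η̂⟫ > 1/2` of `Disproof.lean`/`three_sphere_cap` for crux 13478, and it is empty for `|η| ≥ 2ε`.
[ChapmanCowling1970 §16.21; folklore] -/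
theorem overlap_iff_inner_gt {ε : ℝ} (hε : 0 < ε) (ω η : V3) (hω : ‖ω‖ = 1) :
    ‖ε • ω - η‖ < ε ↔ ‖η‖ ^ 2 / (2 * ε) < ⟪ω, η⟫ := by
  have h1 : ‖ε • ω - η‖ ^ 2 = ε ^ 2 - 2 * ε * ⟪ω, η⟫ + ‖η‖ ^ 2 := by
    rw [norm_sub_sq_real, norm_smul, Real.norm_of_nonneg hε.le, hω, inner_smul_left]
    simp
    ring
  have hpos : 0 ≤ ‖ε • ω - η‖ := norm_nonneg _
  rw [div_lt_iff₀ (by positivity)]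
  constructor
  · intro h
    have h2 : ‖ε • ω - η‖ ^ 2 < ε ^ 2 := by nlinarith
    rw [h1] at h2
    nlinarith
  · intro h
    have h2 : ‖ε • ω - η‖ ^ 2 < ε ^ 2 := by rw [h1]; nlinarith
    nlinarith

end Summit.AtomisticToContinuum.HydrodynamicLimit.Cruxes.KickFairRelEquilibrium.AffineFibreStatics
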